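import Mathlib
import HarnessLib
import Literature.NumberTheory.DiophantineGeometry.BelyiDegree

/-!
# Chart change for genus-0 Belyi witnesses

Elementary polynomial algebra over `ℂ`, all proved, no named facts: the passage from the
normal form of a degree-`n` Belyi map `φ = P/Q : ℙ¹ → ℙ¹` with FOUR AFFINE marked fibre points
of prescribed cross-ratio `q` and `∞ ∉ φ⁻¹{0,1,∞}` (coprime `P, Q ∈ ℂ[X]`,
`deg P = deg Q = deg (P − Q) = n`, `n + 2` distinct roots of `P·Q·(P − Q)` — the equality case of
Riemann–Hurwitz / Mason–Stothers — and distinct roots `x, y, z, w` with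
`(w − x)(y − z) = q·(w − z)(y − x)`; this is the witness predicate inlined in route
ABC/BelyiSqueeze) to the chart in which the marked point `x` sits at `∞`
(`max (deg P') (deg Q') = n`, a degree drop among `P', Q', P' − Q'`, `n + 1` distinct affine
roots, three distinct affine marked roots `y', z', w'` with `y' − z' = q·(w' − z')`; the shape
of `Literature.NumberTheory.DiophantineGeometry.BelyiMapBadPrimeLe` and, with
`(z', w', y') = (0, 1, q)`, of route ABC/BelyiDegreeSmooth). The change of coordinate is
`u ↦ (u − x)⁻¹`: a translation (`Polynomial.taylor`) followed by an inversion
(`Polynomial.reflect`). Used by `BelyiDegreeBadPrimes.lean` to serve both abc routes from one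
cited fact.

## Contents

* `BelyiWitness.mem_roots_toFinset`, `BelyiWitness.ne_of_card_eq_four` — bookkeeping;
* `BelyiWitness.reflect_eval_eq_zero_iff`, `…natDegree_reflect_eq`, `…natDegree_reflect_lt` —
  roots and degree of a reflected polynomial;
* `BelyiWitness.toInftyChart` — the chart change.
* `BelyiWitness.hasBelyiWitness_of_inftyChart` — affine normalisation `(z', w', y') ↦ (0, 1, q)` of
  the `∞`-chart, landing in the tree's witness predicate `HasBelyiWitness n q`
  (`BelyiDegree.lean`); `HasBelyiWitness.of_crossRatio` — the composite: a cross-ratio-`q` witness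
  of degree `n` (route ABC/BelyiSqueeze) yields `HasBelyiWitness n q`.
-/

namespace Literature.NumberTheory.DiophantineGeometry

open Polynomial

namespace BelyiWitness

/-- Membership in the finite set of roots. [folklore] -/
theorem mem_roots_toFinset {f : ℂ[X]} {u : ℂ} : u ∈ f.roots.toFinset ↔ f ≠ 0 ∧ f.eval u = 0 := by
  rw [Multiset.mem_toFinset, mem_roots', IsRoot.def]

/-- Four points with `#{x, y, z, w} = 4` are pairwise distinct. [folklore] -/
theorem ne_of_card_eq_four {x y z w : ℂ} (h : ({x, y, z, w} : Finset ℂ).card = 4) :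
    x ≠ y ∧ x ≠ z ∧ x ≠ w ∧ y ≠ z ∧ y ≠ w ∧ z ≠ w := by
  have hx : x ∉ ({y, z, w} : Finset ℂ) := fun hm => by
    rw [Finset.insert_eq_of_mem hm] at h
    have h3 : ({y, z, w} : Finset ℂ).card ≤ 3 := Finset.card_le_three
    omega
  have h3 : ({y, z, w} : Finset ℂ).card = 3 := by
    rw [Finset.card_insert_of_notMem hx] at h; omega
  have hy : y ∉ ({z, w} : Finset ℂ) := fun hm => by
    rw [Finset.insert_eq_of_mem hm] at h3
    have h2 : ({z, w} : Finset ℂ).card ≤ 2 := Finset.card_le_two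
    omega
  have h2 : ({z, w} : Finset ℂ).card = 2 := by
    rw [Finset.card_insert_of_notMem hy] at h3; omega
  have hzw : z ≠ w := fun he => by
    rw [he] at h2; simp at h2
  simp only [Finset.mem_insert, Finset.mem_singleton, not_or] at hx hy
  exact ⟨hx.1, hx.2.1, hx.2.2, hy.1, hy.2, hzw⟩

/-- Roots of a reflected polynomial at a nonzero point are the inverses of the roots.
[folklore] -/
theorem reflect_eval_eq_zero_iff {N : ℕ} {f : ℂ[X]} (hf : f.natDegree ≤ N) {u : ℂ} (hu : u ≠ 0) :
    (reflect N f).eval u = 0 ↔ f.eval u⁻¹ = 0 := by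
  haveI : Invertible u⁻¹ := invertibleOfNonzero (inv_ne_zero hu)
  have h := eval₂_reflect_eq_zero_iff (RingHom.id ℂ) u⁻¹ N f hf
  rw [invOf_eq_inv, inv_inv] at h
  exact h

/-- The reflection `reflect N f` has degree at most `N` when `deg f ≤ N`. [folklore] -/
theorem natDegree_reflect_le' {N : ℕ} {f : ℂ[X]} (hf : f.natDegree ≤ N) :
    (reflect N f).natDegree ≤ N :=
  natDegree_reflect_le.trans (max_le le_rfl hf)

/-- The top coefficient of `reflect N f` is the constant coefficient of `f`. [folklore] -/
theorem coeff_reflect_self {N : ℕ} (f : ℂ[X]) : (reflect N f).coeff N = f.coeff 0 := by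
  rw [coeff_reflect, revAt_le le_rfl, Nat.sub_self]

/-- The value of `reflect N f` at `0` is the coefficient of `X ^ N` in `f`. [folklore] -/
theorem eval_zero_reflect {N : ℕ} (f : ℂ[X]) : (reflect N f).eval 0 = f.coeff N := by
  rw [← coeff_zero_eq_eval_zero, coeff_reflect, revAt_zero]

/-- If `f(0) ≠ 0` then `reflect N f` has degree exactly `N` (`deg f ≤ N`). [folklore] -/
theorem natDegree_reflect_eq {N : ℕ} {f : ℂ[X]} (hf : f.natDegree ≤ N) (h0 : f.coeff 0 ≠ 0) :
    (reflect N f).natDegree = N :=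
  le_antisymm (natDegree_reflect_le' hf) (le_natDegree_of_ne_zero (by rwa [coeff_reflect_self]))

/-- If `f(0) = 0` then `reflect N f` drops degree (`deg f ≤ N`, `0 < N`). [folklore] -/
theorem natDegree_reflect_lt {N : ℕ} {f : ℂ[X]} (hf : f.natDegree ≤ N) (h0 : f.coeff 0 = 0)
    (hN : 0 < N) : (reflect N f).natDegree < N := by
  refine lt_of_le_of_ne (natDegree_reflect_le' hf) fun heq => ?_
  by_cases hr : reflect N f = 0
  · rw [hr, natDegree_zero] at heq; omega
  · have hlc : (reflect N f).leadingCoeff ≠ 0 := leadingCoeff_ne_zero.mpr hr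
    rw [leadingCoeff, heq, coeff_reflect_self] at hlc
    exact hlc h0

/-- **Chart change.** From a degree-`n` Belyi witness in the normal form of route
ABC/BelyiSqueeze (coprime `P, Q` with `deg P = deg Q = deg (P − Q) = n`, so `∞` is not a fibre
point; `n + 2` distinct roots of `P·Q·(P − Q)`; four distinct such roots `x, y, z, w` of
cross-ratio `((w − x)(y − z))/((w − z)(y − x)) = q`) to a degree-`n` witness in the chart of
`BelyiMapBadPrimeLe` with the SAME `q`: translate `x` to `0` (`taylor x`) and invert the
coordinate (`reflect n`), so that `x ↦ ∞` and `u ↦ (u − x)⁻¹` on the other fibre points; the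
cross-ratio identity `CR(∞, q; 0, 1) = q` becomes the affine relation `y' − z' = q·(w' − z')`.
[folklore] -/
theorem toInftyChart {q : ℂ} {n : ℕ} {P Q : ℂ[X]} {x y z w : ℂ} (hcop : IsCoprime P Q)
    (hP : P.natDegree = n) (hQ : Q.natDegree = n) (hPQ : (P - Q).natDegree = n)
    (hcard : (P * Q * (P - Q)).roots.toFinset.card = n + 2)
    (h4 : ({x, y, z, w} : Finset ℂ).card = 4)
    (hsub : {x, y, z, w} ⊆ (P * Q * (P - Q)).roots.toFinset)
    (hcr : (w - x) * (y - z) = q * ((w - z) * (y - x))) :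
    ∃ (P' Q' : ℂ[X]) (y' z' w' : ℂ), IsCoprime P' Q' ∧ max P'.natDegree Q'.natDegree = n ∧
      (P'.natDegree < n ∨ Q'.natDegree < n ∨ (P' - Q').natDegree < n) ∧
      (P' * Q' * (P' - Q')).roots.toFinset.card = n + 1 ∧ ({y', z', w'} : Finset ℂ).card = 3 ∧
      {y', z', w'} ⊆ (P' * Q' * (P' - Q')).roots.toFinset ∧ y' - z' = q * (w' - z') := by
  obtain ⟨hxy, hxz, hxw, hyz, hyw, hzw⟩ := ne_of_card_eq_four h4
  -- the fibre polynomial `R`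
  obtain ⟨R, hR⟩ : ∃ R, R = P * Q * (P - Q) := ⟨_, rfl⟩
  rw [← hR] at hcard hsub
  have hR0 : R ≠ 0 := by
    intro h; rw [h, roots_zero, Multiset.toFinset_zero, Finset.card_empty] at hcard; omega
  have hP0 : P ≠ 0 := fun h => hR0 (by rw [hR, h, zero_mul, zero_mul])
  have hQ0 : Q ≠ 0 := fun h => hR0 (by rw [hR, h, mul_zero, zero_mul])
  have hPQ0 : P - Q ≠ 0 := fun h => hR0 (by rw [hR, h, mul_zero])
  have hRdeg : R.natDegree = 3 * n := by
    rw [hR, natDegree_mul (mul_ne_zero hP0 hQ0) hPQ0, natDegree_mul hP0 hQ0, hP, hQ, hPQ]; ring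
  have hn : 0 < n := by
    have h1 : R.roots.toFinset.card ≤ R.natDegree :=
      (Multiset.toFinset_card_le _).trans (card_roots' R)
    omega
  have hmem : ∀ u ∈ ({x, y, z, w} : Finset ℂ), R.eval u = 0 := fun u hu =>
    (mem_roots_toFinset.mp (hsub hu)).2
  have hxR : R.eval x = 0 := hmem x (by simp)
  have hyR : R.eval y = 0 := hmem y (by simp)
  have hzR : R.eval z = 0 := hmem z (by simp)
  have hwR : R.eval w = 0 := hmem w (by simp)
  -- Step 1: translate `x` to `0`
  obtain ⟨P₁, hP₁⟩ : ∃ P₁, P₁ = taylor x P := ⟨_, rfl⟩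
  obtain ⟨Q₁, hQ₁⟩ : ∃ Q₁, Q₁ = taylor x Q := ⟨_, rfl⟩
  have hPQ₁ : P₁ - Q₁ = taylor x (P - Q) := by rw [hP₁, hQ₁, map_sub]
  have hR₁ : P₁ * Q₁ * (P₁ - Q₁) = taylor x R := by rw [hPQ₁, hP₁, hQ₁, hR, taylor_mul, taylor_mul]
  have hP₁deg : P₁.natDegree = n := by rw [hP₁, natDegree_taylor, hP]
  have hQ₁deg : Q₁.natDegree = n := by rw [hQ₁, natDegree_taylor, hQ]
  have hPQ₁deg : (P₁ - Q₁).natDegree = n := by rw [hPQ₁, natDegree_taylor, hPQ]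
  have hcop₁ : IsCoprime P₁ Q₁ := by
    have h := hcop.map (taylorAlgHom x).toRingHom
    rw [hP₁, hQ₁]; simpa using h
  have hP₁0 : P₁ ≠ 0 := by rw [hP₁, Ne, taylor_eq_zero]; exact hP0
  have hQ₁0 : Q₁ ≠ 0 := by rw [hQ₁, Ne, taylor_eq_zero]; exact hQ0
  have hPQ₁0 : P₁ - Q₁ ≠ 0 := by rw [hPQ₁, Ne, taylor_eq_zero]; exact hPQ0
  have hev₁ : ∀ u, (P₁ * Q₁ * (P₁ - Q₁)).eval u = R.eval (u + x) := fun u => by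
    rw [hR₁, taylor_eval]
  have hP₁c : P₁.coeff 0 = P.eval x := by rw [hP₁, taylor_coeff_zero]
  have hQ₁c : Q₁.coeff 0 = Q.eval x := by rw [hQ₁, taylor_coeff_zero]
  have hPQ₁c : (P₁ - Q₁).coeff 0 = P.eval x - Q.eval x := by
    rw [hPQ₁, taylor_coeff_zero, eval_sub]
  -- Step 2: invert the coordinate
  obtain ⟨P', hP'⟩ : ∃ P', P' = reflect n P₁ := ⟨_, rfl⟩
  obtain ⟨Q', hQ'⟩ : ∃ Q', Q' = reflect n Q₁ := ⟨_, rfl⟩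
  have hPQ' : P' - Q' = reflect n (P₁ - Q₁) := by rw [hP', hQ', reflect_sub]
  have hev' : ∀ u, u ≠ 0 → ((P' * Q' * (P' - Q')).eval u = 0 ↔ R.eval (u⁻¹ + x) = 0) := by
    intro u hu
    rw [eval_mul, eval_mul, mul_eq_zero, mul_eq_zero, hPQ', hP', hQ',
      reflect_eval_eq_zero_iff hP₁deg.le hu, reflect_eval_eq_zero_iff hQ₁deg.le hu,
      reflect_eval_eq_zero_iff hPQ₁deg.le hu, ← hev₁, eval_mul, eval_mul, mul_eq_zero,
      mul_eq_zero]
  have hP'0ev : P'.eval 0 ≠ 0 := by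
    rw [hP', eval_zero_reflect, ← hP₁deg]; exact leadingCoeff_ne_zero.mpr hP₁0
  have hQ'0ev : Q'.eval 0 ≠ 0 := by
    rw [hQ', eval_zero_reflect, ← hQ₁deg]; exact leadingCoeff_ne_zero.mpr hQ₁0
  have hPQ'0ev : (P' - Q').eval 0 ≠ 0 := by
    rw [hPQ', eval_zero_reflect, ← hPQ₁deg]; exact leadingCoeff_ne_zero.mpr hPQ₁0
  have hev'0 : (P' * Q' * (P' - Q')).eval 0 ≠ 0 := by
    rw [eval_mul, eval_mul]; exact mul_ne_zero (mul_ne_zero hP'0ev hQ'0ev) hPQ'0ev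
  have hR'0 : P' * Q' * (P' - Q') ≠ 0 := fun h => hev'0 (by rw [h, eval_zero])
  -- the new root set
  have hroots : (P' * Q' * (P' - Q')).roots.toFinset =
      (R.roots.toFinset.erase x).image (fun u => (u - x)⁻¹) := by
    ext u
    rw [mem_roots_toFinset, Finset.mem_image]
    constructor
    · rintro ⟨-, hu⟩
      have hu0 : u ≠ 0 := fun h => hev'0 (h ▸ hu)
      refine ⟨u⁻¹ + x, ?_, by simp⟩
      rw [Finset.mem_erase, mem_roots_toFinset]
      exact ⟨fun h => (inv_ne_zero hu0) (by simpa using h), hR0, (hev' u hu0).mp hu⟩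
    · rintro ⟨v, hv, rfl⟩
      rw [Finset.mem_erase, mem_roots_toFinset] at hv
      obtain ⟨hvx, -, hvR⟩ := hv
      have hvx' : v - x ≠ 0 := sub_ne_zero.mpr hvx
      refine ⟨hR'0, (hev' _ (inv_ne_zero hvx')).mpr ?_⟩
      rw [inv_inv, sub_add_cancel]; exact hvR
  have hinj : Set.InjOn (fun u : ℂ => (u - x)⁻¹) ↑(R.roots.toFinset.erase x) := by
    intro u _ v _ huv
    dsimp only at huv
    exact sub_left_inj.mp (inv_inj.mp huv)
  have hcard' : (P' * Q' * (P' - Q')).roots.toFinset.card = n + 1 := by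
    rw [hroots, Finset.card_image_of_injOn hinj,
      Finset.card_erase_of_mem (mem_roots_toFinset.mpr ⟨hR0, hxR⟩), hcard]
    rfl
  -- Step 3: degrees and coprimality in the new chart
  have hnc : ¬ (P.eval x = 0 ∧ Q.eval x = 0) := fun ⟨h1, h2⟩ => by
    have h := (Polynomial.isCoprime_iff_aeval_ne_zero_of_isAlgClosed ℂ ℂ P Q).mp hcop x
    simp [coe_aeval_eq_eval, h1, h2] at h
  have hP'le : P'.natDegree ≤ n := hP' ▸ natDegree_reflect_le' hP₁deg.le
  have hQ'le : Q'.natDegree ≤ n := hQ' ▸ natDegree_reflect_le' hQ₁deg.le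
  have hmax : max P'.natDegree Q'.natDegree = n := by
    rcases eq_or_ne (P.eval x) 0 with hPx | hPx
    · have hQx : Q.eval x ≠ 0 := fun h => hnc ⟨hPx, h⟩
      have hQ'n : Q'.natDegree = n := hQ' ▸ natDegree_reflect_eq hQ₁deg.le (by rwa [hQ₁c])
      rw [hQ'n]; exact max_eq_right hP'le
    · have hP'n : P'.natDegree = n := hP' ▸ natDegree_reflect_eq hP₁deg.le (by rwa [hP₁c])
      rw [hP'n]; exact max_eq_left hQ'le
  have hdrop : P'.natDegree < n ∨ Q'.natDegree < n ∨ (P' - Q').natDegree < n := by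
    have hx3 : P.eval x = 0 ∨ Q.eval x = 0 ∨ P.eval x - Q.eval x = 0 := by
      have h := hxR
      rw [hR, eval_mul, eval_mul, eval_sub] at h
      rcases mul_eq_zero.mp h with h | h
      · rcases mul_eq_zero.mp h with h | h
        · exact Or.inl h
        · exact Or.inr (Or.inl h)
      · exact Or.inr (Or.inr h)
    rcases hx3 with h | h | h
    · exact Or.inl (hP' ▸ natDegree_reflect_lt hP₁deg.le (by rw [hP₁c, h]) hn)
    · exact Or.inr (Or.inl (hQ' ▸ natDegree_reflect_lt hQ₁deg.le (by rw [hQ₁c, h]) hn))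
    · exact Or.inr (Or.inr (hPQ' ▸ natDegree_reflect_lt hPQ₁deg.le (by rw [hPQ₁c, h]) hn))
  have hcop' : IsCoprime P' Q' := by
    rw [Polynomial.isCoprime_iff_aeval_ne_zero_of_isAlgClosed ℂ ℂ]
    intro a
    simp only [coe_aeval_eq_eval]
    by_cases ha : a = 0
    · left; rw [ha]; exact hP'0ev
    · have h := (Polynomial.isCoprime_iff_aeval_ne_zero_of_isAlgClosed ℂ ℂ P₁ Q₁).mp hcop₁ a⁻¹
      simp only [coe_aeval_eq_eval] at h
      rcases h with h | h
      · left; rwa [Ne, hP', reflect_eval_eq_zero_iff hP₁deg.le ha]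
      · right; rwa [Ne, hQ', reflect_eval_eq_zero_iff hQ₁deg.le ha]
  -- Step 4: the marked points `(y - x)⁻¹, (z - x)⁻¹, (w - x)⁻¹`
  have hyx : y - x ≠ 0 := sub_ne_zero.mpr (Ne.symm hxy)
  have hzx : z - x ≠ 0 := sub_ne_zero.mpr (Ne.symm hxz)
  have hwx : w - x ≠ 0 := sub_ne_zero.mpr (Ne.symm hxw)
  refine ⟨P', Q', (y - x)⁻¹, (z - x)⁻¹, (w - x)⁻¹, hcop', hmax, hdrop, hcard', ?_, ?_, ?_⟩
  · rw [Finset.card_eq_three]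
    refine ⟨(y - x)⁻¹, (z - x)⁻¹, (w - x)⁻¹, ?_, ?_, ?_, rfl⟩
    · exact fun h => hyz (sub_left_inj.mp (inv_inj.mp h))
    · exact fun h => hyw (sub_left_inj.mp (inv_inj.mp h))
    · exact fun h => hzw (sub_left_inj.mp (inv_inj.mp h))
  · intro u hu
    rw [hroots, Finset.mem_image]
    simp only [Finset.mem_insert, Finset.mem_singleton] at hu
    rcases hu with rfl | rfl | rfl
    · exact ⟨y, Finset.mem_erase.mpr ⟨Ne.symm hxy, mem_roots_toFinset.mpr ⟨hR0, hyR⟩⟩, rfl⟩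
    · exact ⟨z, Finset.mem_erase.mpr ⟨Ne.symm hxz, mem_roots_toFinset.mpr ⟨hR0, hzR⟩⟩, rfl⟩
    · exact ⟨w, Finset.mem_erase.mpr ⟨Ne.symm hxw, mem_roots_toFinset.mpr ⟨hR0, hwR⟩⟩, rfl⟩
  · rw [inv_sub_inv hyx hzx, inv_sub_inv hwx hzx, ← mul_div_assoc,
      div_eq_div_iff (mul_ne_zero hyx hzx) (mul_ne_zero hwx hzx)]
    linear_combination (-(z - x)) * hcr

end BelyiWitness


/-! ### Affine normalisation: from the `∞`-chart to `HasBelyiWitness` -/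

namespace BelyiWitness

/-- **Affine normalisation.** A degree-`n` witness in the `∞`-chart with three distinct affine
marked fibre points `y, z, w` satisfying `y − z = q·(w − z)` gives `HasBelyiWitness n q`:
precompose with the affine map `u ↦ (w − z)·u + z`, which sends `0 ↦ z`, `1 ↦ w`, `q ↦ y` and
fixes `∞`; degrees, coprimality and the number of distinct affine fibre points are unchanged.
[folklore] -/
theorem hasBelyiWitness_of_inftyChart {q : ℂ} {n : ℕ} {P Q : ℂ[X]} {y z w : ℂ}
    (hcop : IsCoprime P Q) (hmax : max P.natDegree Q.natDegree = n)
    (hdrop : P.natDegree < n ∨ Q.natDegree < n ∨ (P - Q).natDegree < n)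
    (hcard : (P * Q * (P - Q)).roots.toFinset.card = n + 1)
    (h3 : ({y, z, w} : Finset ℂ).card = 3) (hsub : {y, z, w} ⊆ (P * Q * (P - Q)).roots.toFinset)
    (hrel : y - z = q * (w - z)) : HasBelyiWitness n q := by
  classical
  -- `w ≠ z` (the three marked points are distinct)
  have hwz : w - z ≠ 0 := by
    intro h
    have hwz' : w = z := sub_eq_zero.mp h
    rw [hwz'] at h3
    have : ({y, z, z} : Finset ℂ).card ≤ 2 :=
      calc ({y, z, z} : Finset ℂ).card = ({y, z} : Finset ℂ).card := by simp
        _ ≤ 2 := Finset.card_le_two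
    omega
  -- the affine substitution
  set α : ℂ := w - z with hα
  set L : ℂ[X] := C α * X + C z with hL
  have hunit : IsUnit α := isUnit_iff_ne_zero.mpr hwz
  have hLdeg : L.natDegree = 1 := natDegree_linear hwz
  have hdegc : ∀ f : ℂ[X], (f.comp L).natDegree = f.natDegree := fun f => by
    rw [natDegree_comp, hLdeg, mul_one]
  have key : P.comp L * Q.comp L * (P.comp L - Q.comp L) = (P * Q * (P - Q)).comp L := by
    rw [mul_comp, mul_comp, sub_comp]
  have hevL : ∀ u, L.eval u = α * u + z := fun u => by
    simp [hL]
  have hR0 : P * Q * (P - Q) ≠ 0 := by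
    intro h; rw [h, roots_zero, Multiset.toFinset_zero, Finset.card_empty] at hcard; omega
  have hmem : ∀ u ∈ ({y, z, w} : Finset ℂ), (P * Q * (P - Q)).eval u = 0 := fun u hu =>
    (mem_roots_toFinset.mp (hsub hu)).2
  refine ⟨P.comp L, Q.comp L, ?_, ?_, ?_, ?_, ?_, ?_, ?_⟩
  · obtain ⟨u, v, huv⟩ := hcop
    exact ⟨u.comp L, v.comp L, by rw [← mul_comp, ← mul_comp, ← add_comp, huv, one_comp]⟩
  · rw [hdegc, hdegc, hmax]
  · rw [← sub_comp, hdegc, hdegc, hdegc]; exact hdrop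
  · have hinj : Function.Injective (fun x : ℂ => Ring.inverse α * (x - z)) := by
      intro u v huv
      have h := congrArg (fun t => α * t) huv
      simp only [← mul_assoc, Ring.mul_inverse_cancel α hunit, one_mul, sub_left_inj] at h
      exact h
    rw [key, roots_comp_C_mul_X_add_C _ _ _ hunit, Multiset.toFinset_map,
      Finset.card_image_of_injective _ hinj, hcard]
  · rw [key, eval_comp, hevL, mul_zero, zero_add]; exact hmem z (by simp)
  · rw [key, eval_comp, hevL, mul_one, hα, sub_add_cancel]; exact hmem w (by simp)
  · rw [key, eval_comp, hevL]
    have : α * q + z = y := by rw [hα]; linear_combination -hrel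
    rw [this]; exact hmem y (by simp)

end BelyiWitness

/-- **From the cross-ratio normal form to `HasBelyiWitness`.** A degree-`n` Belyi witness in the
normal form of route ABC/BelyiSqueeze — coprime `P, Q ∈ ℂ[X]` with `deg P = deg Q = deg (P − Q) = n`
(`∞` not a fibre point), `n + 2` distinct roots of `P·Q·(P − Q)`, four distinct such roots
`x, y, z, w` with `(w − x)(y − z) = q·(w − z)(y − x)` (cross-ratio `q`) — yields
`HasBelyiWitness n q`, the tree's witness predicate for `(ℙ¹; 0, 1, ∞, q)` (normal form of route
ABC/BelyiDegreeSmooth): move `x` to `∞` (`BelyiWitness.toInftyChart`) and normalise affinely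
(`BelyiWitness.hasBelyiWitness_of_inftyChart`). In particular `belyiDegree q ≤ n`. [folklore] -/
theorem HasBelyiWitness.of_crossRatio {q : ℂ} {n : ℕ} {P Q : ℂ[X]} {x y z w : ℂ}
    (hcop : IsCoprime P Q) (hP : P.natDegree = n) (hQ : Q.natDegree = n)
    (hPQ : (P - Q).natDegree = n) (hcard : (P * Q * (P - Q)).roots.toFinset.card = n + 2)
    (h4 : ({x, y, z, w} : Finset ℂ).card = 4)
    (hsub : {x, y, z, w} ⊆ (P * Q * (P - Q)).roots.toFinset)
    (hcr : (w - x) * (y - z) = q * ((w - z) * (y - x))) : HasBelyiWitness n q := by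
  obtain ⟨P', Q', y', z', w', hcop', hmax, hdrop, hcard', h3, hsub', hrel⟩ :=
    BelyiWitness.toInftyChart hcop hP hQ hPQ hcard h4 hsub hcr
  exact BelyiWitness.hasBelyiWitness_of_inftyChart hcop' hmax hdrop hcard' h3 hsub' hrel

/-- The Belyi degree of `(ℙ¹; 0, 1, ∞, q)` is at most the degree of any cross-ratio-`q` witness
(normal form of route ABC/BelyiSqueeze). [folklore] -/
theorem belyiDegree_le_of_crossRatio {q : ℂ} {n : ℕ} {P Q : ℂ[X]} {x y z w : ℂ}
    (hcop : IsCoprime P Q) (hP : P.natDegree = n) (hQ : Q.natDegree = n)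
    (hPQ : (P - Q).natDegree = n) (hcard : (P * Q * (P - Q)).roots.toFinset.card = n + 2)
    (h4 : ({x, y, z, w} : Finset ℂ).card = 4)
    (hsub : {x, y, z, w} ⊆ (P * Q * (P - Q)).roots.toFinset)
    (hcr : (w - x) * (y - z) = q * ((w - z) * (y - x))) : belyiDegree q ≤ n :=
  belyiDegree_le (HasBelyiWitness.of_crossRatio hcop hP hQ hPQ hcard h4 hsub hcr)

end Literature.NumberTheory.DiophantineGeometry
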